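import Summits.PneNP.PneNP.Theorems.OverlapGapAlgebraNoStableSectionGlue1
import Literature.Combinatorics.BinomialEntropyBound

/-!
# Crux `NoStableSection` (stmt-PneNP-2462), line `DartGame` — glue 2: fixed `k`, `n → ∞`

For a fixed `k` and parameters satisfying the `k`-dependent inequalities (hypotheses), the
crux's count is `≤ e^{-(L/2) n} · #paths` for all large `n` (polynomial prefactors absorbed by
`isLittleO_pow_exp_pos_mul_atTop`; binomial sums by van Lint's bound; `m = ⌊α n⌋₊`).
Registered sub-goal `stub_gluePolyExp`. Lead prover-line-stmt-PneNP-2462-0.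
-/

namespace Summit.PneNP.PneNP.Cruxes.NoStableSection.DartGame

set_option linter.dupNamespace false -- `Summit.PneNP.PneNP.…`: summit = sub-problem (D-0017)

open Finset Real

/-! ## Glue, part 3a: fixed `k`, `n → ∞` -/

section FixedK

open Finset Filter Real
open scoped Classical Topology

variable {k m n : ℕ}

/-- Polynomials lose to exponentials, eventually in `n : ℕ`. -/
theorem glue_poly_le_exp_eventually (d : ℕ) (A a : ℝ) (ha : 0 < a) :
    ∀ᶠ n : ℕ in atTop, A * ((n : ℝ) + 2) ^ d ≤ Real.exp (a * n) := by
  have h1 : (fun x : ℝ => x ^ d) =o[atTop] fun x => Real.exp (a / 2 * x) :=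
    isLittleO_pow_exp_pos_mul_atTop d (half_pos ha)
  have h2 : Tendsto (fun n : ℕ => (n : ℝ) + 2) atTop atTop :=
    tendsto_atTop_add_const_right _ _ tendsto_natCast_atTop_atTop
  have h3 : ∀ᶠ n : ℕ in atTop, ((n : ℝ) + 2) ^ d ≤ Real.exp (a / 2 * ((n : ℝ) + 2)) := by
    have := (h1.comp_tendsto h2).eventuallyLE
    filter_upwards [this] with n hn
    simpa [Function.comp, abs_of_nonneg (by positivity : (0 : ℝ) ≤ (n : ℝ) + 2),
      abs_of_pos (Real.exp_pos _)] using hn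
  -- and `|A| e^{a} e^{(a/2) n} ≤ e^{a n}` eventually
  have h4 : ∀ᶠ n : ℕ in atTop, |A| * Real.exp a ≤ Real.exp (a / 2 * n) := by
    have ht : Tendsto (fun n : ℕ => Real.exp (a / 2 * n)) atTop atTop :=
      tendsto_exp_atTop.comp (Tendsto.const_mul_atTop (half_pos ha) tendsto_natCast_atTop_atTop)
    exact ht.eventually_ge_atTop _
  filter_upwards [h3, h4] with n h3 h4
  have hn0 : (0 : ℝ) ≤ ((n : ℝ) + 2) ^ d := by positivity
  calc A * ((n : ℝ) + 2) ^ d ≤ |A| * ((n : ℝ) + 2) ^ d :=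
        mul_le_mul_of_nonneg_right (le_abs_self A) hn0
    _ ≤ |A| * Real.exp (a / 2 * ((n : ℝ) + 2)) := mul_le_mul_of_nonneg_left h3 (abs_nonneg A)
    _ = |A| * Real.exp a * Real.exp (a / 2 * n) := by
        rw [show a / 2 * ((n : ℝ) + 2) = a + a / 2 * n by ring, Real.exp_add]; ring
    _ ≤ Real.exp (a / 2 * n) * Real.exp (a / 2 * n) :=
        mul_le_mul_of_nonneg_right h4 (Real.exp_nonneg _)
    _ = Real.exp (a * n) := by rw [← Real.exp_add]; ring_nf

/-- `(1 - x)^N ≤ e^{-xN}` for `0 ≤ x ≤ 1`. -/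
theorem glue_one_sub_pow_le {x : ℝ} (_hx0 : 0 ≤ x) (hx1 : x ≤ 1) (N : ℕ) :
    (1 - x) ^ N ≤ Real.exp (-(x * N)) := by
  have h : 1 - x ≤ Real.exp (-x) := by linarith [Real.add_one_le_exp (-x)]
  calc (1 - x) ^ N ≤ (Real.exp (-x)) ^ N := pow_le_pow_left₀ (by linarith) h N
    _ = Real.exp (-(x * N)) := by rw [← Real.exp_nat_mul]; ring_nf

/-- van Lint's bound in the form used here. -/
theorem glue_sum_choose_le (m' : ℕ) {l : ℝ} (h0 : 0 ≤ l) (h1 : l ≤ 1 / 2) {J' : ℕ}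
    (hJ : J' ≤ ⌊l * m'⌋₊) :
    ∑ j ∈ range (J' + 1), (m'.choose j : ℝ) ≤ Real.exp (m' * binEntropy l) := by
  refine le_trans ?_ (Literature.Combinatorics.vanLint_sum_choose_le_exp_binEntropy m' h0 h1)
  exact sum_le_sum_of_subset_of_nonneg (range_subset_range.2 (by omega)) fun _ _ _ => by positivity

set_option maxHeartbeats 400000 in
/-- **The estimate for a fixed `k`** (all `k`-dependent inequalities as hypotheses; `n → ∞`). -/
theorem glue_fixed_k (hA : LadderExtraction) (hB : EntropyToolkit) (hC : CondEntCount)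
    (hE : PathValidCount) (hF : IndepCount) (hEn : EnergyBound) (hk : 2 ≤ k)
    {η ν bm bp θ L α : ℝ} (hη0 : 0 < η) (hη2 : η ≤ 1 / 2) (hν0 : 0 < ν)
    (hνk : ((k : ℝ) + 1) * ν ≤ 1 / 2) (hbm : 0 < bm) (hwin : binEntropy η ≤ bp - bm) (hθ0 : 0 < θ)
    (hθ1 : θ < 1) (hθb : 2 * θ ≤ bm) (hL : 0 < L) (hα : 0 < α)
    (hD0 : 0 ≤ (1 : ℝ) + k * (1 - (2 * (1 - (bm - 2 * θ) / (-Real.log θ)) ^ k +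
      k * ((bm - 2 * θ) / (-Real.log θ)) * (1 - (bm - 2 * θ) / (-Real.log θ)) ^ (k - 1))) -
      θ * ((k : ℝ) * (k + 1) / 2))
    (hI : bp + α * binEntropy ν - (1 / 2 : ℝ) ^ k * (1 - ν) * α ≤ -(2 * L))
    (hO : Real.log 2 + k * bp + α * binEntropy (((k : ℝ) + 1) * ν) -
      (1 / 2 : ℝ) ^ k * α * ((1 : ℝ) + k * (1 - (2 * (1 - (bm - 2 * θ) / (-Real.log θ)) ^ k +
      k * ((bm - 2 * θ) / (-Real.log θ)) * (1 - (bm - 2 * θ) / (-Real.log θ)) ^ (k - 1))) -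
      θ * ((k : ℝ) * (k + 1) / 2)) * (1 - ((k : ℝ) + 1) * ν) ≤ -(2 * L)) :
    ∀ᶠ n : ℕ in atTop, ∀ m : ℕ, m = ⌊α * n⌋₊ → ∀ g : Inst m k n → Fin n → Bool,
      ((univ.filter fun Ψ : PathSp k m n => StableValid g η ν Ψ).card : ℝ) ≤
        Real.exp (-(L / 2 * n)) * Fintype.card (PathSp k m n) := by
  -- abbreviations (made opaque: `clear_value`)
  set p₀ : ℝ := (bm - 2 * θ) / (-Real.log θ) with hp₀
  set D : ℝ := (1 : ℝ) + k * (1 - (2 * (1 - p₀) ^ k + k * p₀ * (1 - p₀) ^ (k - 1))) -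
    θ * ((k : ℝ) * (k + 1) / 2) with hD
  clear_value p₀ D
  have hk1 : 1 ≤ k := by omega
  have hν1 : ν ≤ 1 / 2 := by
    have hk0 : (0 : ℝ) ≤ k := Nat.cast_nonneg k
    nlinarith
  have hνk0 : 0 ≤ 1 - ((k : ℝ) + 1) * ν := by linarith
  have hbp : 0 ≤ bp := by linarith [binEntropy_nonneg hη0.le (by linarith : η ≤ 1)]
  have hhalf : (0 : ℝ) ≤ (1 / 2 : ℝ) ^ k := by positivity
  have hhalf1 : (1 / 2 : ℝ) ^ k ≤ 1 := pow_le_one₀ (by norm_num) (by norm_num)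
  -- polynomial prefactors
  obtain ⟨A₁, hA₁⟩ : ∃ A₁ : ℝ, A₁ = ((k : ℝ) + 1) * ((k : ℝ) ^ 2 * α + 1) ^ (k + 1) * Real.exp 1 :=
    ⟨_, rfl⟩
  obtain ⟨A₂, hA₂⟩ : ∃ A₂ : ℝ, A₂ = ((k : ℝ) ^ 2 * α + 1) ^ (k + 1) * Real.exp (D * (k + 2)) :=
    ⟨_, rfl⟩
  have ev1 := glue_poly_le_exp_eventually (k + 1 + 2 ^ k) A₁ L hL
  have ev2 := glue_poly_le_exp_eventually (k + 1 + k * 2 ^ k) A₂ L hL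
  -- `m` large
  have ev3 : ∀ᶠ n : ℕ in atTop, (2 * ((k : ℝ) + 1) + 2) ≤ α * n - 1 := by
    have ht : Tendsto (fun n : ℕ => α * n - 1) atTop atTop :=
      tendsto_atTop_add_const_right _ _ (Tendsto.const_mul_atTop hα tendsto_natCast_atTop_atTop)
    exact ht.eventually_ge_atTop _
  -- `2 e^{-L n} ≤ e^{-(L/2) n}`
  have ev4 : ∀ᶠ n : ℕ in atTop, Real.log 2 ≤ L / 2 * n := by
    have ht : Tendsto (fun n : ℕ => L / 2 * n) atTop atTop :=
      Tendsto.const_mul_atTop (half_pos hL) tendsto_natCast_atTop_atTop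
    exact ht.eventually_ge_atTop _
  filter_upwards [ev1, ev2, ev3, ev4] with n hn1 hn2 hn3 hn4 m hm g
  -- facts about `m`
  have hnn : (0 : ℝ) ≤ n := Nat.cast_nonneg n
  have hαn : 0 ≤ α * n := by positivity
  have hm_le : (m : ℝ) ≤ α * n := by rw [hm]; exact Nat.floor_le hαn
  have hm_ge : α * n - 1 ≤ m := by rw [hm]; exact (Nat.sub_one_lt_floor _).le
  have hm2 : 2 * ((k : ℝ) + 1) + 2 ≤ m := hn3.trans hm_ge
  have hk0 : (0 : ℝ) ≤ k := Nat.cast_nonneg k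
  have hm0 : (0 : ℝ) ≤ m := Nat.cast_nonneg m
  have hm1 : 1 ≤ m := by
    have : (1 : ℝ) ≤ m := by linarith
    exact_mod_cast this
  have hn1' : 1 ≤ n := by
    rcases Nat.eq_zero_or_pos n with hn0 | h
    · exfalso
      rw [hn0] at hn3
      simp only [Nat.cast_zero, mul_zero, zero_sub] at hn3
      linarith
    · exact h
  have hW : 0 < m * k := Nat.mul_pos (by omega) (by omega)
  have hJle : (⌊ν * (m : ℝ)⌋₊ : ℝ) ≤ ν * m := Nat.floor_le (by positivity)
  have hkJ : ((k : ℝ) + 1) * ⌊ν * (m : ℝ)⌋₊ ≤ (m : ℝ) / 2 := by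
    calc ((k : ℝ) + 1) * ⌊ν * (m : ℝ)⌋₊ ≤ ((k : ℝ) + 1) * (ν * m) :=
          mul_le_mul_of_nonneg_left hJle (by positivity)
      _ = (((k : ℝ) + 1) * ν) * m := by ring
      _ ≤ (1 / 2) * m := mul_le_mul_of_nonneg_right hνk hm0
      _ = m / 2 := by ring
  have hslots : 0 ≤ (m : ℝ) - (k + 1) * ⌊ν * (m : ℝ)⌋₊ - (k + 1) := by linarith
  -- (1) decomposition: `#SV ≤ #IB + #OB`
  have hdec : ((univ.filter fun Ψ : PathSp k m n => StableValid g η ν Ψ).card : ℝ) ≤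
      ((univ.filter fun Ψ : PathSp k m n => IndepBad g ν bp Ψ).card : ℝ) +
      ((univ.filter fun Ψ : PathSp k m n => OgpBad k m n ν bm bp Ψ).card : ℝ) := by
    have hsub : (univ.filter fun Ψ : PathSp k m n => StableValid g η ν Ψ) ⊆
        (univ.filter fun Ψ : PathSp k m n => IndepBad g ν bp Ψ) ∪
        (univ.filter fun Ψ : PathSp k m n => OgpBad k m n ν bm bp Ψ) := by
      intro Ψ hΨ
      simp only [mem_filter, mem_univ, true_and, mem_union] at hΨ ⊢
      by_cases hI : IndepBad g ν bp Ψ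
      · exact Or.inl hI
      · exact Or.inr (glue_ogpBad_of_stableValid hA hB hk1 hW hη0.le hη2 hbm.le hwin hΨ hI)
    calc ((univ.filter fun Ψ : PathSp k m n => StableValid g η ν Ψ).card : ℝ)
        ≤ (((univ.filter fun Ψ : PathSp k m n => IndepBad g ν bp Ψ) ∪
            (univ.filter fun Ψ : PathSp k m n => OgpBad k m n ν bm bp Ψ)).card : ℝ) := by
          exact_mod_cast card_le_card hsub
      _ ≤ _ := by exact_mod_cast card_union_le _ _
  -- (2) the energy bound for admissible ladders
  have hDY : ∀ Y : Fin (k + 1) → Fin n → Bool,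
      (∀ ℓ : Fin (k + 1), 1 ≤ (ℓ : ℕ) → condEnt (seqOf Y) ℓ ∈ Set.Icc bm bp) →
      D ≤ (energySum (seqOf Y) k : ℝ) / (n : ℝ) ^ k := by
    intro Y hY
    rw [hD]
    refine hEn n k (seqOf Y) θ bm p₀ hn1' hk1 hθ0 hθ1 hθb hp₀ fun ℓ hℓ1 hℓk => ?_
    have := hY ⟨ℓ, Nat.lt_succ_of_le hℓk⟩ hℓ1
    exact this.1
  -- (3) the two first moments
  have hIB := glue_card_indepBad_le (k := k) (m := m) hC hF hn1' g (bp := bp) hν0.le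
  have hOB := glue_card_ogpBad_le (k := k) (m := m) hC hE hn1' hν0.le hbp hD0 hslots hDY
  set J : ℕ := ⌊ν * (m : ℝ)⌋₊ with hJ
  clear_value J
  have hJm : J ≤ m := by
    have h : (J : ℝ) ≤ (m : ℝ) := by
      calc (J : ℝ) ≤ ν * m := hJle
        _ ≤ 1 * m := mul_le_mul_of_nonneg_right (by linarith) hm0
        _ = m := one_mul _
    exact_mod_cast h
  -- (4) the real-analysis bounds on the factors
  set P : ℝ := (Fintype.card (PathSp k m n) : ℝ) with hP
  clear_value P
  have hP0 : 0 ≤ P := by rw [hP]; positivity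
  have hTle : ((k * (m * k) : ℕ) + 1 : ℝ) ≤ ((k : ℝ) ^ 2 * α + 1) * ((n : ℝ) + 2) := by
    have h1 : ((k * (m * k) : ℕ) : ℝ) = (k : ℝ) ^ 2 * m := by push_cast; ring
    have h2 : (k : ℝ) ^ 2 * m ≤ (k : ℝ) ^ 2 * (α * n) :=
      mul_le_mul_of_nonneg_left hm_le (sq_nonneg _)
    have h3 : 0 ≤ (k : ℝ) ^ 2 * α := by positivity
    have h4 : ((k : ℝ) ^ 2 * α + 1) * ((n : ℝ) + 2) =
        (k : ℝ) ^ 2 * (α * n) + 2 * ((k : ℝ) ^ 2 * α) + n + 2 := by ring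
    rw [h1, h4]
    linarith
  have hT0 : (0 : ℝ) ≤ ((k * (m * k) : ℕ) + 1 : ℝ) := by positivity
  have hn12 : ((n : ℝ) + 1) ≤ (n : ℝ) + 2 := by linarith
  -- binomial sums
  have hN₁ : ∑ j ∈ range (J + 1), (m.choose j : ℝ) ≤ Real.exp (m * binEntropy ν) :=
    glue_sum_choose_le m hν0.le hν1 (by rw [hJ])
  have hN₂ : ∑ j ∈ range ((k + 1) * J + 1), (m.choose j : ℝ) ≤
      Real.exp (m * binEntropy (((k : ℝ) + 1) * ν)) := by
    refine glue_sum_choose_le m (by positivity) hνk (Nat.le_floor ?_)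
    push_cast
    rw [mul_assoc]
    exact mul_le_mul_of_nonneg_left hJle (by positivity)
  have hpowJ : (1 - (1 / 2 : ℝ) ^ k) ^ (m - J) ≤ Real.exp (-((1 / 2 : ℝ) ^ k * ((1 - ν) * m))) := by
    refine (glue_one_sub_pow_le hhalf hhalf1 (m - J)).trans (Real.exp_le_exp.2 (neg_le_neg ?_))
    refine mul_le_mul_of_nonneg_left ?_ hhalf
    rw [Nat.cast_sub hJm]
    linarith
  -- entropy terms: `m H ≤ α n H`
  have hH1 : (m : ℝ) * binEntropy ν ≤ α * n * binEntropy ν :=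
    mul_le_mul_of_nonneg_right hm_le (binEntropy_nonneg hν0.le (by linarith))
  have hH2 : (m : ℝ) * binEntropy (((k : ℝ) + 1) * ν) ≤ α * n * binEntropy (((k : ℝ) + 1) * ν) :=
    mul_le_mul_of_nonneg_right hm_le (binEntropy_nonneg (by positivity) (by linarith))
  -- (5) the `S_indep` total
  have hIBtot : ((univ.filter fun Ψ : PathSp k m n => IndepBad g ν bp Ψ).card : ℝ) ≤
      Real.exp (-(L * n)) * P := by
    refine hIB.trans ?_
    -- the four `n`-dependent factors
    have hF1 : ((n : ℝ) + 1) ^ (2 ^ k) ≤ ((n : ℝ) + 2) ^ (2 ^ k) :=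
      pow_le_pow_left₀ (by positivity) hn12 _
    have h4pos : 0 ≤ (1 - (1 / 2 : ℝ) ^ k) ^ (m - J) := pow_nonneg (by linarith) _
    have hprod : ((n : ℝ) + 1) ^ (2 ^ k) * Real.exp (n * bp) *
        (∑ j ∈ range (J + 1), (m.choose j : ℝ)) * (1 - (1 / 2 : ℝ) ^ k) ^ (m - J) ≤
        ((n : ℝ) + 2) ^ (2 ^ k) * Real.exp (n * bp) * Real.exp (m * binEntropy ν) *
          Real.exp (-((1 / 2 : ℝ) ^ k * ((1 - ν) * m))) := by
      have h12 : ((n : ℝ) + 1) ^ (2 ^ k) * Real.exp (n * bp) ≤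
          ((n : ℝ) + 2) ^ (2 ^ k) * Real.exp (n * bp) :=
        mul_le_mul_of_nonneg_right hF1 (Real.exp_nonneg _)
      have h123 := mul_le_mul h12 hN₁ (by positivity) (by positivity)
      exact mul_le_mul h123 hpowJ h4pos (by positivity)
    have hexp : Real.exp (n * bp) * Real.exp (m * binEntropy ν) *
        Real.exp (-((1 / 2 : ℝ) ^ k * ((1 - ν) * m))) ≤ Real.exp 1 * Real.exp (-(2 * L) * n) := by
      rw [← Real.exp_add, ← Real.exp_add, ← Real.exp_add]
      refine Real.exp_le_exp.2 ?_
      have h1 : (1 / 2 : ℝ) ^ k * ((1 - ν) * (α * n - 1)) ≤ (1 / 2 : ℝ) ^ k * ((1 - ν) * m) :=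
        mul_le_mul_of_nonneg_left (mul_le_mul_of_nonneg_left hm_ge (by linarith)) hhalf
      have h2 : (1 / 2 : ℝ) ^ k * (1 - ν) ≤ 1 := mul_le_one₀ hhalf1 (by linarith) (by linarith)
      have h3 := mul_le_mul_of_nonneg_right hI hnn
      linarith
    have hpre : ((k : ℝ) + 1) * ((k * (m * k) : ℕ) + 1 : ℝ) ^ (k + 1) * ((n : ℝ) + 2) ^ (2 ^ k) *
        Real.exp 1 ≤ A₁ * ((n : ℝ) + 2) ^ (k + 1 + 2 ^ k) := by
      have hT' : ((k * (m * k) : ℕ) + 1 : ℝ) ^ (k + 1) ≤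
          (((k : ℝ) ^ 2 * α + 1) * ((n : ℝ) + 2)) ^ (k + 1) := pow_le_pow_left₀ hT0 hTle _
      calc ((k : ℝ) + 1) * ((k * (m * k) : ℕ) + 1 : ℝ) ^ (k + 1) * ((n : ℝ) + 2) ^ (2 ^ k) *
            Real.exp 1
          ≤ ((k : ℝ) + 1) * (((k : ℝ) ^ 2 * α + 1) * ((n : ℝ) + 2)) ^ (k + 1) *
            ((n : ℝ) + 2) ^ (2 ^ k) * Real.exp 1 := by
            have := mul_le_mul_of_nonneg_left hT' (by positivity : (0 : ℝ) ≤ (k : ℝ) + 1)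
            exact mul_le_mul_of_nonneg_right (mul_le_mul_of_nonneg_right this (by positivity))
              (Real.exp_nonneg _)
        _ = A₁ * ((n : ℝ) + 2) ^ (k + 1 + 2 ^ k) := by rw [hA₁, mul_pow, pow_add]; ring
    calc ((k : ℝ) + 1) * ((k * (m * k) : ℕ) + 1 : ℝ) ^ (k + 1) *
          (((n : ℝ) + 1) ^ (2 ^ k) * Real.exp (n * bp) *
            (∑ j ∈ range (J + 1), (m.choose j : ℝ)) * (1 - (1 / 2 : ℝ) ^ k) ^ (m - J) * P)
        ≤ ((k : ℝ) + 1) * ((k * (m * k) : ℕ) + 1 : ℝ) ^ (k + 1) *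
          (((n : ℝ) + 2) ^ (2 ^ k) * (Real.exp 1 * Real.exp (-(2 * L) * n)) * P) := by
          refine mul_le_mul_of_nonneg_left ?_ (by positivity)
          refine mul_le_mul_of_nonneg_right ?_ hP0
          calc ((n : ℝ) + 1) ^ (2 ^ k) * Real.exp (n * bp) *
                (∑ j ∈ range (J + 1), (m.choose j : ℝ)) * (1 - (1 / 2 : ℝ) ^ k) ^ (m - J)
              ≤ ((n : ℝ) + 2) ^ (2 ^ k) * Real.exp (n * bp) * Real.exp (m * binEntropy ν) *
                Real.exp (-((1 / 2 : ℝ) ^ k * ((1 - ν) * m))) := hprod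
            _ = ((n : ℝ) + 2) ^ (2 ^ k) * (Real.exp (n * bp) * Real.exp (m * binEntropy ν) *
                Real.exp (-((1 / 2 : ℝ) ^ k * ((1 - ν) * m)))) := by ring
            _ ≤ ((n : ℝ) + 2) ^ (2 ^ k) * (Real.exp 1 * Real.exp (-(2 * L) * n)) :=
                mul_le_mul_of_nonneg_left hexp (by positivity)
      _ = ((k : ℝ) + 1) * ((k * (m * k) : ℕ) + 1 : ℝ) ^ (k + 1) * ((n : ℝ) + 2) ^ (2 ^ k) *
          Real.exp 1 * (Real.exp (-(2 * L) * n) * P) := by ring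
      _ ≤ A₁ * ((n : ℝ) + 2) ^ (k + 1 + 2 ^ k) * (Real.exp (-(2 * L) * n) * P) :=
          mul_le_mul_of_nonneg_right hpre (by positivity)
      _ ≤ Real.exp (L * n) * (Real.exp (-(2 * L) * n) * P) :=
          mul_le_mul_of_nonneg_right hn1 (by positivity)
      _ = Real.exp (-(L * n)) * P := by rw [← mul_assoc, ← Real.exp_add]; ring_nf
  -- (6) the `S_ogp` total (big sub-expressions made opaque)
  obtain ⟨Tf, hTf⟩ : ∃ x : ℝ, x = ((k * (m * k) : ℕ) + 1 : ℝ) ^ (k + 1) := ⟨_, rfl⟩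
  obtain ⟨F, hFd⟩ : ∃ x : ℝ, x = (2 : ℝ) ^ n * (((n : ℝ) + 1) ^ (2 ^ k) * Real.exp (n * bp)) ^ k :=
    ⟨_, rfl⟩
  obtain ⟨G, hGd⟩ : ∃ x : ℝ, x = (∑ j ∈ range ((k + 1) * J + 1), (m.choose j : ℝ)) *
      Real.exp (-((1 / 2 : ℝ) ^ k * D * ((m : ℝ) - (k + 1) * J - (k + 1)))) := ⟨_, rfl⟩
  obtain ⟨F', hF'd⟩ : ∃ x : ℝ, x = Real.exp (n * Real.log 2) *
      (((n : ℝ) + 2) ^ (k * 2 ^ k) * Real.exp (k * (n * bp))) := ⟨_, rfl⟩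
  obtain ⟨G', hG'd⟩ : ∃ x : ℝ, x = Real.exp (m * binEntropy (((k : ℝ) + 1) * ν)) *
      Real.exp (-((1 / 2 : ℝ) ^ k * D * ((1 - ((k : ℝ) + 1) * ν) * m - (k + 1)))) := ⟨_, rfl⟩
  have hOB' : ((univ.filter fun Ψ : PathSp k m n => OgpBad k m n ν bm bp Ψ).card : ℝ) ≤
      Tf * F * (G * P) := by rw [hTf, hFd, hGd]; exact hOB
  have hF0 : 0 ≤ F := by rw [hFd]; positivity
  have hG0 : 0 ≤ G := by rw [hGd]; positivity
  have hTf0 : 0 ≤ Tf := by rw [hTf]; positivity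
  have h2n : (2 : ℝ) ^ n = Real.exp (n * Real.log 2) := by
    rw [Real.exp_nat_mul, Real.exp_log two_pos]
  have hFF' : F ≤ F' := by
    rw [hFd, hF'd, h2n]
    refine mul_le_mul_of_nonneg_left ?_ (Real.exp_nonneg _)
    calc (((n : ℝ) + 1) ^ (2 ^ k) * Real.exp (n * bp)) ^ k
        ≤ (((n : ℝ) + 2) ^ (2 ^ k) * Real.exp (n * bp)) ^ k :=
          pow_le_pow_left₀ (by positivity)
            (mul_le_mul_of_nonneg_right (pow_le_pow_left₀ (by positivity) hn12 _)
              (Real.exp_nonneg _)) _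
      _ = ((n : ℝ) + 2) ^ (k * 2 ^ k) * Real.exp (k * (n * bp)) := by
          rw [mul_pow, ← Real.exp_nat_mul, pow_mul', ← pow_mul, mul_comm (2 ^ k) k]
  have hGG' : G ≤ G' := by
    rw [hGd, hG'd]
    refine mul_le_mul hN₂ (Real.exp_le_exp.2 (neg_le_neg ?_)) (Real.exp_nonneg _) (Real.exp_nonneg _)
    refine mul_le_mul_of_nonneg_left ?_ (mul_nonneg hhalf hD0)
    linarith [mul_le_mul_of_nonneg_left hJle (by positivity : (0 : ℝ) ≤ (k : ℝ) + 1)]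
  have hexp : F' * G' ≤ ((n : ℝ) + 2) ^ (k * 2 ^ k) * (Real.exp (D * (k + 2)) *
      Real.exp (-(2 * L) * n)) := by
    have hFG' : F' * G' = ((n : ℝ) + 2) ^ (k * 2 ^ k) * Real.exp (n * Real.log 2 + k * (n * bp) +
        (m * binEntropy (((k : ℝ) + 1) * ν) +
          -((1 / 2 : ℝ) ^ k * D * ((1 - ((k : ℝ) + 1) * ν) * m - (k + 1))))) := by
      rw [hF'd, hG'd, Real.exp_add, Real.exp_add, Real.exp_add]; ring
    rw [hFG', ← Real.exp_add]
    refine mul_le_mul_of_nonneg_left (Real.exp_le_exp.2 ?_) (by positivity)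
    have h1 : (1 / 2 : ℝ) ^ k * D * ((1 - ((k : ℝ) + 1) * ν) * (α * n - 1) - (k + 1)) ≤
        (1 / 2 : ℝ) ^ k * D * ((1 - ((k : ℝ) + 1) * ν) * m - (k + 1)) := by
      refine mul_le_mul_of_nonneg_left ?_ (mul_nonneg hhalf hD0)
      linarith [mul_le_mul_of_nonneg_left hm_ge hνk0]
    have h2 : (1 / 2 : ℝ) ^ k * D * ((1 - ((k : ℝ) + 1) * ν) + (k + 1)) ≤ D * (k + 2) := by
      have h21 : (1 / 2 : ℝ) ^ k * D ≤ D := mul_le_of_le_one_left hD0 hhalf1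
      have h22 : (1 - ((k : ℝ) + 1) * ν) + (k + 1) ≤ (k : ℝ) + 2 := by
        have : 0 ≤ ((k : ℝ) + 1) * ν := by positivity
        linarith
      calc (1 / 2 : ℝ) ^ k * D * ((1 - ((k : ℝ) + 1) * ν) + (k + 1))
          ≤ D * ((1 - ((k : ℝ) + 1) * ν) + (k + 1)) :=
            mul_le_mul_of_nonneg_right h21 (by linarith)
        _ ≤ D * ((k : ℝ) + 2) := mul_le_mul_of_nonneg_left h22 hD0
    have h3 := mul_le_mul_of_nonneg_right hO hnn
    linarith
  have hpre : Tf * ((n : ℝ) + 2) ^ (k * 2 ^ k) * Real.exp (D * (k + 2)) ≤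
      A₂ * ((n : ℝ) + 2) ^ (k + 1 + k * 2 ^ k) := by
    have hT' : Tf ≤ (((k : ℝ) ^ 2 * α + 1) * ((n : ℝ) + 2)) ^ (k + 1) := by
      rw [hTf]; exact pow_le_pow_left₀ hT0 hTle _
    calc Tf * ((n : ℝ) + 2) ^ (k * 2 ^ k) * Real.exp (D * (k + 2))
        ≤ (((k : ℝ) ^ 2 * α + 1) * ((n : ℝ) + 2)) ^ (k + 1) * ((n : ℝ) + 2) ^ (k * 2 ^ k) *
          Real.exp (D * (k + 2)) :=
          mul_le_mul_of_nonneg_right (mul_le_mul_of_nonneg_right hT' (by positivity))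
            (Real.exp_nonneg _)
      _ = A₂ * ((n : ℝ) + 2) ^ (k + 1 + k * 2 ^ k) := by rw [hA₂, mul_pow, pow_add]; ring
  have hOBtot : ((univ.filter fun Ψ : PathSp k m n => OgpBad k m n ν bm bp Ψ).card : ℝ) ≤
      Real.exp (-(L * n)) * P := by
    have hFG : F * G ≤ F' * G' := mul_le_mul hFF' hGG' hG0 (hF0.trans hFF')
    calc ((univ.filter fun Ψ : PathSp k m n => OgpBad k m n ν bm bp Ψ).card : ℝ)
        ≤ Tf * F * (G * P) := hOB'
      _ = Tf * (F * G) * P := by ring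
      _ ≤ Tf * (((n : ℝ) + 2) ^ (k * 2 ^ k) * (Real.exp (D * (k + 2)) *
          Real.exp (-(2 * L) * n))) * P :=
          mul_le_mul_of_nonneg_right (mul_le_mul_of_nonneg_left (hFG.trans hexp) hTf0) hP0
      _ = Tf * ((n : ℝ) + 2) ^ (k * 2 ^ k) * Real.exp (D * (k + 2)) *
          (Real.exp (-(2 * L) * n) * P) := by ring
      _ ≤ A₂ * ((n : ℝ) + 2) ^ (k + 1 + k * 2 ^ k) * (Real.exp (-(2 * L) * n) * P) :=
          mul_le_mul_of_nonneg_right hpre (by positivity)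
      _ ≤ Real.exp (L * n) * (Real.exp (-(2 * L) * n) * P) :=
          mul_le_mul_of_nonneg_right hn2 (by positivity)
      _ = Real.exp (-(L * n)) * P := by rw [← mul_assoc, ← Real.exp_add]; ring_nf
  -- (7) conclude
  have hfin : 2 * Real.exp (-(L * n)) ≤ Real.exp (-(L / 2 * n)) := by
    have h := mul_le_mul_of_nonneg_right (Real.exp_le_exp.2 hn4) (Real.exp_nonneg (-(L * n)))
    rw [Real.exp_log two_pos, ← Real.exp_add] at h
    have he : L / 2 * n + -(L * n) = -(L / 2 * n) := by ring
    rwa [he] at h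
  calc ((univ.filter fun Ψ : PathSp k m n => StableValid g η ν Ψ).card : ℝ)
      ≤ Real.exp (-(L * n)) * P + Real.exp (-(L * n)) * P := hdec.trans (add_le_add hIBtot hOBtot)
    _ = 2 * Real.exp (-(L * n)) * P := by ring
    _ ≤ Real.exp (-(L / 2 * n)) * P := mul_le_mul_of_nonneg_right hfin hP0


end FixedK

/-! ## Registered sub-goal of this file -/

/-- **Sub-goal `stub_gluePolyExp`** (registered on stmt-PneNP-2462): polynomial prefactors are
absorbed by the exponential rate, eventually in `n`. -/
theorem stub_gluePolyExp : ∀ (d : ℕ) (A a : ℝ), 0 < a → ∀ᶠ n : ℕ in Filter.atTop, A * ((n : ℝ) + 2) ^ d ≤ Real.exp (a * n) :=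
  fun d A a ha => glue_poly_le_exp_eventually d A a ha

end Summit.PneNP.PneNP.Cruxes.NoStableSection.DartGame
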